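import Mathlib.Geometry.Manifold.VectorBundle.CovariantDerivative.Basic
import Mathlib.Geometry.Manifold.VectorBundle.LocalFrame
import Mathlib.Geometry.Manifold.MFDeriv.Basic
import Mathlib.Geometry.Manifold.IsManifold.InteriorBoundary
import Mathlib.Analysis.Calculus.Deriv.Basic
import Literature.Geometry.Lorentzian.LorentzianMetric
import Literature.Geometry.Lorentzian.LeviCivita
import HarnessLib

-- provenance: harness21/H21/H21/Prelude/Lorentz/Geodesic.lean @ 5c8a8e7 (interim HEAD d8f2665); M5 mechanical rewrite
/-!
# Geodesics and geodesic completeness (trunk G08 = T-LORENTZ, item C6)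

For a bundled covariant derivative `cov : CovariantDerivative I E (TangentSpace I : M → Type _)`
on the tangent bundle of a real manifold `M` (finite-dimensional complete model space `E`) we
define

* `velocity γ t`: the velocity `γ'(t) = dγ_t(1) ∈ T_{γ t} M` of a curve `γ : ℝ → M` (`mfderiv`);
  `tangentLift γ : ℝ → TangentBundle I M`, the curve `t ↦ (γ t, γ' t)`;
* `curveThrough x v`: the chart-straight curve through `x` with velocity `v` at `t = 0`;
* `covariantDerivAlongFrame cov e b γ W t₀`, `covariantDerivAlong cov γ W t₀`: the **covariant
  derivative `DW/dt` of a vector field `W` along `γ`**, by the local-frame formula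
  `DW/dt = ∑ᵢ (cⁱ)' sᵢ + ∑ᵢ cⁱ ∇_{γ'} sᵢ` (O'Neill 1983, Ch. 3, Prop. 3.18) in the frame `sᵢ` induced by
  a trivialisation `e` and a basis `b` of `E` (`Trivialization.localFrame`), with `W = ∑ cⁱ sᵢ`;
  frame independence `covariantDerivAlongFrame_eq` and the Leibniz rule `covariantDerivAlong_smul`;
* `IsGeodesicOn cov γ s` (**gr.S26**), `IsGeodesic`, `IsMaximalGeodesicOn`, `IsGeodesicallyComplete`,
  local existence `exists_isGeodesicOn_nhds_zero` and existence/uniqueness of maximal geodesics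
  `existsUnique_isMaximalGeodesicOn` (O'Neill 1983, Ch. 3, Lemma 3.22, Prop. 3.28 ff.);
* for a Lorentzian metric `g` with Levi-Civita connection `∇` and a time orientation `τ`:
  `LorentzianMetric.IsTimelike/Null/CausalGeodesicallyComplete g`,
  `LorentzianMetric.IsFutureNull/TimelikeGeodesicallyIncomplete g τ` (Hawking–Ellis 1973, §8.1:
  a singularity is causal geodesic incompleteness).

## Mathlib

Mathlib (at the pin) has `mfderiv`, integral curves of vector fields (`IsMIntegralCurve`, with
existence/uniqueness in `Mathlib/Geometry/Manifold/IntegralCurve/`), bundled covariant derivatives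
`CovariantDerivative I F V` with the smoothness class `ContMDiffCovariantDerivative`, and local
frames `Trivialization.localFrame` / `Trivialization.localFrame_coeff`; it has no covariant
derivative along curves, no geodesics and no completeness notions
(`rg -i geodesic Mathlib/Geometry` is empty). Everything below is built from these Mathlib pieces.

## Design choices

* **Second-order regularity.** The frame formula differentiates the coefficient functions
  `t ↦ cⁱ(t)` with the one-variable `deriv`, whose junk value is `0` at non-differentiable points.
  To avoid spurious "geodesics" (a `C¹` curve with nowhere-differentiable velocity would satisfy
  `∑ (cⁱ)' sᵢ + … = 0` by junk), `IsGeodesicOn` asks that the tangent lift `t ↦ (γ t, γ' t)` be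
  differentiable (as a curve in `TM`) at every `t ∈ s`, which is the honest hypothesis of the
  second-order geodesic equation, and then that `D(γ')/dt = 0` on `s`.
* `covariantDerivAlong` uses the canonical frame at `γ t₀` (`trivializationAt`, `Module.finBasis`);
  `covariantDerivAlongFrame_eq` records (sorried, true) independence of the frame.
* Domains of geodesics are arbitrary sets `s ⊆ ℝ` in `IsGeodesicOn`; maximal geodesics live on
  open order-connected sets (open intervals, possibly unbounded). Since a curve `γ : ℝ → M` is
  total, uniqueness of the maximal geodesic is stated as equality of domains and `EqOn`.
* Existence and uniqueness theorems assume a `C¹` connection (`ContMDiffCovariantDerivative cov 1`,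
  so that the geodesic ODE is locally Lipschitz), interior initial points / boundaryless `M`, and
  `T2Space M` (bump functions to globalise local frames; uniqueness of limits), in the spirit of
  Mathlib's integral-curve theorems.
* Cross-fibre equations such as `velocity γ 0 = v` with `v : TangentSpace I x` and `γ 0 = x` only
  propositionally elaborate because `TangentSpace I y = E` definitionally for every `y`.
* No global `FiniteDimensional ℝ (TangentSpace I x)` instance is used or registered.
* The completeness / incompleteness NOTIONS (`IsGeodesicallyComplete`,
  `LorentzianMetric.IsTimelike/Null/CausalGeodesicallyComplete`,
  `LorentzianMetric.IsFutureNull/TimelikeGeodesicallyIncomplete`) are definitions — predicates on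
  a connection, a metric or a time orientation — and bind that datum explicitly in their own
  signature (not only through a section `variable`), so that they read as predicates and are not
  mistaken for closed named facts; none of them holds for every metric (Hawking–Ellis 1973,
  §8.1, p. 257: cutting a regular point out of space-time destroys all three kinds of
  completeness; O'Neill 1983, Ch. 3, p. 68).

## References

* B. O'Neill, *Semi-Riemannian geometry with applications to relativity*, Academic Press 1983,
  Ch. 3: Prop. 3.18 (induced covariant derivative along a curve), Def. 3.19–Lemma 3.22
  (geodesics, local existence and uniqueness), Prop. 3.28 ff. (exponential map), Def. before 3.29
  (maximal geodesics, geodesic completeness); Ch. 5, p. 130 ff.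
* S. W. Hawking, G. F. R. Ellis, *The large scale structure of space-time*, CUP 1973, §8.1
  (timelike / null / causal geodesic completeness; singularities as incompleteness).
-/

noncomputable section

open Bundle Set
open scoped Manifold ContDiff Topology

namespace Literature.Geometry.Lorentzian

variable {E : Type*} [NormedAddCommGroup E] [NormedSpace ℝ E] {H : Type*} [TopologicalSpace H]
  (I : ModelWithCorners ℝ E H) {M : Type*} [TopologicalSpace M] [ChartedSpace H M]

/-! ### Velocity of a curve, tangent lift, chart-straight curves -/

/-- The **velocity** `γ'(t) = dγ_t(1) ∈ T_{γ(t)} M` of a curve `γ : ℝ → M` at parameter `t`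
(Mathlib's `mfderiv` applied to the unit vector `1 ∈ T_t ℝ = ℝ`; junk value `0` where `γ` is not
differentiable). O'Neill 1983, Ch. 1, Def. 1.15 ff.; Ch. 3, p. 65. [cite: ONeill1983, Ch. 1, Def. 1.15 ff] -/
def velocity (γ : ℝ → M) (t : ℝ) : TangentSpace I (γ t) :=
  mfderiv 𝓘(ℝ, ℝ) I γ t (1 : ℝ)

/-- The **tangent lift** `t ↦ (γ(t), γ'(t))` of a curve `γ : ℝ → M` to the tangent bundle `TM`.
Its differentiability at `t` expresses that `γ` is twice differentiable at `t`.
O'Neill 1983, Ch. 3, p. 65 (the vector field `γ'` along `γ`). [cite: ONeill1983, Ch. 3, p. 65] -/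
def tangentLift (γ : ℝ → M) (t : ℝ) : TangentBundle I M :=
  TotalSpace.mk' E (γ t) (velocity I γ t)

/-- The base point of the tangent lift is the curve. [folklore] -/
@[simp]
lemma tangentLift_proj (γ : ℝ → M) (t : ℝ) : (tangentLift I γ t).proj = γ t := rfl

/-- The fibre component of the tangent lift is the velocity. [folklore] -/
@[simp]
lemma tangentLift_snd (γ : ℝ → M) (t : ℝ) : (tangentLift I γ t).snd = velocity I γ t := rfl

/-- The **chart-straight curve through `x` with initial velocity `v`**:
`t ↦ φ⁻¹(φ(x) + t v)` for the extended chart `φ = extChartAt I x` at `x`. It passes through `x` at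
`t = 0` and, at interior points, has velocity `v` there (`velocity_curveThrough_zero`); it is used
to realise every tangent vector as the velocity of a curve. O'Neill 1983, Ch. 1, proof of
Prop. 1.16. [cite: ONeill1983, Ch. 1, proof of Prop. 1.16] -/
def curveThrough (x : M) (v : TangentSpace I x) : ℝ → M :=
  fun t ↦ (extChartAt I x).symm (extChartAt I x x + t • (show E from v))

/-- The chart-straight curve passes through `x` at `t = 0`. O'Neill 1983, Ch. 1, Prop. 1.16. [cite: ONeill1983, Ch. 1, Prop. 1.16] -/
@[simp]
lemma curveThrough_zero (x : M) (v : TangentSpace I x) : curveThrough I x v 0 = x := by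
  simp [curveThrough]

variable {I}

/-- At an interior point `x`, the chart-straight curve through `x` with parameter `v` has velocity
`v` at `t = 0` (a cross-fibre equation: both sides live in `E`). O'Neill 1983, Ch. 1,
Prop. 1.16. [cite: ONeill1983, Ch. 1, Prop. 1.16] -/
def velocity_curveThrough_zero : Prop :=
  ∀ [IsManifold I 1 M] {x : M} (hx : I.IsInteriorPoint x) (v : TangentSpace I x),
    velocity I (curveThrough I x v) 0 = v

/-! ### Covariant derivative along a curve -/

section CovariantDerivAlong

variable [IsManifold I ∞ M] [FiniteDimensional ℝ E]
  (cov : CovariantDerivative I E (TangentSpace I : M → Type _))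

/-- The **covariant derivative along `γ` in a given frame**: for a trivialisation `e` of `TM` and a
basis `b` of `E`, with local frame `sᵢ = e.localFrame b i` and coefficient functions
`cⁱ(t) = e.localFrame_coeff I b i (γ t) (W t)` of the vector field `W` along `γ`,
`covariantDerivAlongFrame cov e b γ W t₀ = ∑ᵢ (cⁱ)'(t₀) sᵢ(γ t₀) + ∑ᵢ cⁱ(t₀) ∇_{γ'(t₀)} sᵢ`.
Meaningful when `γ t₀ ∈ e.baseSet` and the lift `t ↦ (γ t, W t)` is differentiable at `t₀`; prefer
`covariantDerivAlong`. O'Neill 1983, Ch. 3, Prop. 3.18 (formula in the proof). [cite: ONeill1983, Ch. 3, Prop. 3.18] -/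
def covariantDerivAlongFrame {ι : Type*} [Fintype ι]
    (e : Trivialization E (TotalSpace.proj : TangentBundle I M → M)) [MemTrivializationAtlas e]
    (b : Module.Basis ι ℝ E) (γ : ℝ → M) (W : Π t : ℝ, TangentSpace I (γ t)) (t₀ : ℝ) :
    TangentSpace I (γ t₀) :=
  ∑ i, deriv (fun t ↦ e.localFrame_coeff I b i (γ t) (W t)) t₀ • e.localFrame b i (γ t₀)
    + ∑ i, e.localFrame_coeff I b i (γ t₀) (W t₀) • cov (e.localFrame b i) (γ t₀) (velocity I γ t₀)

/-- The **covariant derivative `DW/dt (t₀)` of a vector field `W` along a curve `γ`** with respect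
to the connection `cov`, computed by the local-frame formula
`DW/dt = ∑ᵢ (cⁱ)' sᵢ + ∑ᵢ cⁱ ∇_{γ'} sᵢ` in the canonical frame at `γ t₀` (the trivialisation
`trivializationAt E (TangentSpace I) (γ t₀)` and the basis `Module.finBasis ℝ E`). It is the unique
operation which is `ℝ`-linear, Leibniz in `W` (`covariantDerivAlong_smul`) and equals `∇_{γ'} Y`
on restrictions `W = Y ∘ γ` of vector fields. O'Neill 1983, Ch. 3, Prop. 3.18. [cite: ONeill1983, Ch. 3, Prop. 3.18] -/
def covariantDerivAlong (γ : ℝ → M) (W : Π t : ℝ, TangentSpace I (γ t)) (t₀ : ℝ) :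
    TangentSpace I (γ t₀) :=
  covariantDerivAlongFrame cov (trivializationAt E (TangentSpace I : M → Type _) (γ t₀))
    (Module.finBasis ℝ E) γ W t₀

/-- Unfolding lemma: `covariantDerivAlong` is `covariantDerivAlongFrame` in the canonical frame. [folklore] -/
lemma covariantDerivAlong_def (γ : ℝ → M) (W : Π t : ℝ, TangentSpace I (γ t)) (t₀ : ℝ) :
    covariantDerivAlong cov γ W t₀ =
      covariantDerivAlongFrame cov (trivializationAt E (TangentSpace I : M → Type _) (γ t₀))
        (Module.finBasis ℝ E) γ W t₀ := rfl

/-- **Frame independence.** The local-frame formula for `DW/dt (t₀)` does not depend on the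
trivialisation `e ∋ γ t₀` and basis `b` used, provided the lift `t ↦ (γ t, W t)` is differentiable
at `t₀` (change of frame `s'ⱼ = ∑ Aᵢⱼ sᵢ` with `A` smooth, Leibniz rule and locality of `cov`).
O'Neill 1983, Ch. 3, Prop. 3.18 (uniqueness of the induced covariant derivative). [cite: ONeill1983, Ch. 3, Prop. 3.18] -/
def covariantDerivAlongFrame_eq : Prop :=
  ∀ {ι : Type*} [Fintype ι] (e : Trivialization E (TotalSpace.proj : TangentBundle I M → M)) [MemTrivializationAtlas e] (b : Module.Basis ι ℝ E) {γ : ℝ → M} {W : Π t : ℝ, TangentSpace I (γ t)} {t₀ : ℝ} (he : γ t₀ ∈ e.baseSet) (hW : MDifferentiableAt 𝓘(ℝ, ℝ) I.tangent (fun t ↦ (TotalSpace.mk' E (γ t) (W t) : TangentBundle I M)) t₀),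
    covariantDerivAlongFrame cov e b γ W t₀ = covariantDerivAlong cov γ W t₀

/-- **Leibniz rule** for the covariant derivative along a curve:
`D(fW)/dt = f' W + f DW/dt` at `t₀`, for `f` differentiable at `t₀` and `W` with differentiable
lift at `t₀`. O'Neill 1983, Ch. 3, Prop. 3.18 (2). [cite: ONeill1983, Ch. 3, Prop. 3.18] -/
def covariantDerivAlong_smul : Prop :=
  ∀ {γ : ℝ → M} {W : Π t : ℝ, TangentSpace I (γ t)} {f : ℝ → ℝ} {t₀ : ℝ} (hf : DifferentiableAt ℝ f t₀) (hW : MDifferentiableAt 𝓘(ℝ, ℝ) I.tangent (fun t ↦ (TotalSpace.mk' E (γ t) (W t) : TangentBundle I M)) t₀),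
    covariantDerivAlong cov γ (fun t ↦ f t • W t) t₀ =
      deriv f t₀ • W t₀ + f t₀ • covariantDerivAlong cov γ W t₀

/-- **Additivity** of the covariant derivative along a curve: `D(W₁ + W₂)/dt = DW₁/dt + DW₂/dt`
at `t₀`, for `W₁, W₂` with differentiable lifts at `t₀`. O'Neill 1983, Ch. 3, Prop. 3.18 (1). [cite: ONeill1983, Ch. 3, Prop. 3.18] -/
def covariantDerivAlong_add : Prop :=
  ∀ {γ : ℝ → M} {W₁ W₂ : Π t : ℝ, TangentSpace I (γ t)} {t₀ : ℝ} (hW₁ : MDifferentiableAt 𝓘(ℝ, ℝ) I.tangent (fun t ↦ (TotalSpace.mk' E (γ t) (W₁ t) : TangentBundle I M)) t₀) (hW₂ : MDifferentiableAt 𝓘(ℝ, ℝ) I.tangent (fun t ↦ (TotalSpace.mk' E (γ t) (W₂ t) : TangentBundle I M)) t₀),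
    covariantDerivAlong cov γ (fun t ↦ W₁ t + W₂ t) t₀ =
      covariantDerivAlong cov γ W₁ t₀ + covariantDerivAlong cov γ W₂ t₀

/-- **Restriction of a vector field.** For a vector field `Y` on `M` differentiable at `γ t₀` and
`γ` differentiable at `t₀`, `D(Y ∘ γ)/dt (t₀) = ∇_{γ'(t₀)} Y` (recall Mathlib's argument order
`cov Y x v = ∇_v Y`). O'Neill 1983, Ch. 3, Prop. 3.18 (3). [cite: ONeill1983, Ch. 3, Prop. 3.18] -/
def covariantDerivAlong_comp : Prop :=
  ∀ {γ : ℝ → M} {Y : Π x : M, TangentSpace I x} {t₀ : ℝ} (hγ : MDifferentiableAt 𝓘(ℝ, ℝ) I γ t₀) (hY : MDiffAt (T% Y) (γ t₀)),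
    covariantDerivAlong cov γ (fun t ↦ Y (γ t)) t₀ = cov Y (γ t₀) (velocity I γ t₀)

end CovariantDerivAlong

/-! ### Geodesics -/

section Geodesic

variable [IsManifold I ∞ M] [FiniteDimensional ℝ E]
  (cov : CovariantDerivative I E (TangentSpace I : M → Type _))

/-- **gr.S26** (geodesics; O'Neill 1983 Ch. 3 Def. 3.19, Hawking–Ellis §8.1). The curve
`γ : ℝ → M` is a **geodesic of the connection `cov` on the set `s ⊆ ℝ`** (of parameters): at
every `t ∈ s` the curve is twice differentiable (its tangent lift `t ↦ (γ t, γ' t)` is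
differentiable as a curve in `TM`) and its acceleration vanishes, `D(γ')/dt (t) = ∇_{γ'} γ' = 0`.
The parameter of a geodesic is then automatically an **affine parameter** (any two
parametrisations as geodesics differ by `t ↦ a t + b`). O'Neill 1983, Ch. 3, Def. 3.19–3.20. [cite: ONeill1983, Ch. 3 Def. 3.19, Hawking–Ellis §8.1] -/
def IsGeodesicOn (γ : ℝ → M) (s : Set ℝ) : Prop :=
  (∀ t ∈ s, MDifferentiableAt 𝓘(ℝ, ℝ) I.tangent (tangentLift I γ) t) ∧
    ∀ t ∈ s, covariantDerivAlong cov γ (fun t ↦ velocity I γ t) t = 0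

/-- A **geodesic** (defined on the whole real line): `γ` is a geodesic of `cov` on `univ`.
O'Neill 1983, Ch. 3, Def. 3.19; a connection all of whose inextendible geodesics are of this
kind is *complete* (`IsGeodesicallyComplete`). [cite: ONeill1983, Ch. 3, Def. 3.19] -/
def IsGeodesic (γ : ℝ → M) : Prop :=
  IsGeodesicOn cov γ univ

variable {cov}

/-- A geodesic on `s` has differentiable tangent lift on `s`. O'Neill 1983, Ch. 3, Def. 3.19. [cite: ONeill1983, Ch. 3, Def. 3.19] -/
lemma IsGeodesicOn.mdifferentiableAt_tangentLift {γ : ℝ → M} {s : Set ℝ}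
    (h : IsGeodesicOn cov γ s) {t : ℝ} (ht : t ∈ s) :
    MDifferentiableAt 𝓘(ℝ, ℝ) I.tangent (tangentLift I γ) t :=
  h.1 t ht

/-- The geodesic equation `D(γ')/dt = 0` on `s`. O'Neill 1983, Ch. 3, Def. 3.19. [cite: ONeill1983, Ch. 3, Def. 3.19] -/
lemma IsGeodesicOn.covariantDerivAlong_velocity_eq_zero {γ : ℝ → M} {s : Set ℝ}
    (h : IsGeodesicOn cov γ s) {t : ℝ} (ht : t ∈ s) :
    covariantDerivAlong cov γ (fun t ↦ velocity I γ t) t = 0 :=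
  h.2 t ht

/-- A geodesic on `s` is differentiable at every point of `s` (project the tangent lift by the
smooth bundle projection). O'Neill 1983, Ch. 3, Def. 3.19. [cite: ONeill1983, Ch. 3, Def. 3.19] -/
def IsGeodesicOn.mdifferentiableAt : Prop :=
  ∀ {γ : ℝ → M} {s : Set ℝ} (h : IsGeodesicOn cov γ s) {t : ℝ} (ht : t ∈ s),
    MDifferentiableAt 𝓘(ℝ, ℝ) I γ t

/-- Restriction of the parameter set of a geodesic. [folklore] -/
lemma IsGeodesicOn.mono {γ : ℝ → M} {s s' : Set ℝ} (h : IsGeodesicOn cov γ s) (hs : s' ⊆ s) :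
    IsGeodesicOn cov γ s' :=
  ⟨fun t ht ↦ h.1 t (hs ht), fun t ht ↦ h.2 t (hs ht)⟩

/-- A geodesic on `ℝ` is a geodesic on every parameter set. [folklore] -/
lemma IsGeodesic.isGeodesicOn {γ : ℝ → M} (h : IsGeodesic cov γ) (s : Set ℝ) :
    IsGeodesicOn cov γ s :=
  IsGeodesicOn.mono h (subset_univ s)

/-- Being a geodesic on an **open** set `s` only depends on the values of the curve on `s`
(locality of `mfderiv` and of the covariant derivative along a curve: both only see the germ of the
curve). O'Neill 1983, Ch. 3, Def. 3.19 (the geodesic condition is pointwise in `t`). [cite: ONeill1983, Ch. 3, Def. 3.19] -/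
def IsGeodesicOn.congr : Prop :=
  ∀ {γ γ' : ℝ → M} {s : Set ℝ}, IsGeodesicOn cov γ s → IsOpen s → EqOn γ γ' s → IsGeodesicOn cov γ' s

/-- **Affine reparametrisation.** If `γ` is a geodesic on `s`, then `t ↦ γ (a t + b)` is a geodesic
on the preimage of `s`. O'Neill 1983, Ch. 3, Def. 3.20 and Lemma 3.21 ff. [cite: ONeill1983, Ch. 3, Def. 3.20 and Lemma 3.21 ff] -/
def IsGeodesicOn.comp_affine : Prop :=
  ∀ {γ : ℝ → M} {s : Set ℝ} (h : IsGeodesicOn cov γ s) (a b : ℝ),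
    IsGeodesicOn cov (fun t ↦ γ (a * t + b)) ((fun t ↦ a * t + b) ⁻¹' s)

variable (cov)

/-- Constant curves are geodesics. O'Neill 1983, Ch. 3, p. 68. [cite: ONeill1983, Ch. 3, p. 68] -/
def isGeodesic_const : Prop :=
  ∀ (x : M),
    IsGeodesic cov (fun _ : ℝ ↦ x)

/-- `γ` is a **maximal (inextendible) geodesic with domain `s`**: `s` is an open interval of `ℝ`
(an open order-connected set, possibly unbounded), `γ` is a geodesic on `s`, and there is no
geodesic `γ'` on a strictly larger open interval `s' ⊋ s` agreeing with `γ` on `s`.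
O'Neill 1983, Ch. 3, p. 68 (maximal geodesics, geodesic inextendibility); Hawking–Ellis 1973,
§8.1. [cite: ONeill1983, Ch. 3, p. 68] -/
def IsMaximalGeodesicOn (γ : ℝ → M) (s : Set ℝ) : Prop :=
  IsOpen s ∧ s.OrdConnected ∧ IsGeodesicOn cov γ s ∧
    ∀ (γ' : ℝ → M) (s' : Set ℝ), IsOpen s' → s'.OrdConnected → s ⊆ s' → IsGeodesicOn cov γ' s' →
      EqOn γ γ' s → s' = s

variable {cov} in
/-- A maximal geodesic is a geodesic on its domain. [folklore] -/
lemma IsMaximalGeodesicOn.isGeodesicOn {γ : ℝ → M} {s : Set ℝ} (h : IsMaximalGeodesicOn cov γ s) :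
    IsGeodesicOn cov γ s :=
  h.2.2.1

variable {cov} in
/-- The domain of a maximal geodesic is open. [folklore] -/
lemma IsMaximalGeodesicOn.isOpen {γ : ℝ → M} {s : Set ℝ} (h : IsMaximalGeodesicOn cov γ s) :
    IsOpen s :=
  h.1

/-- A geodesic defined on all of `ℝ` is maximal with domain `univ`. O'Neill 1983, Ch. 3, p. 68. [cite: ONeill1983, Ch. 3, p. 68] -/
lemma IsGeodesic.isMaximalGeodesicOn_univ {γ : ℝ → M} (h : IsGeodesic cov γ) :
    IsMaximalGeodesicOn cov γ univ :=
  ⟨isOpen_univ, Set.ordConnected_univ, h, fun _ _ _ _ hs _ _ ↦ univ_subset_iff.mp hs⟩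

/-- The connection `cov` is **geodesically complete**: every tangent vector `v ∈ T_x M` is the
initial velocity of a geodesic `γ : ℝ → M` defined on the whole real line (equivalently, every
maximal geodesic has domain `ℝ`). The equation `velocity I γ 0 = v` compares vectors in the fibres
over `γ 0` and `x`, both equal to `E` by definition. O'Neill 1983, Ch. 3, p. 68 (Def. before
Lemma 3.29); Hawking–Ellis 1973, §8.1. [cite: ONeill1983, Ch. 3, p. 68] -/
def IsGeodesicallyComplete (cov : CovariantDerivative I E (TangentSpace I : M → Type _)) : Prop :=
  ∀ (x : M) (v : TangentSpace I x), ∃ γ : ℝ → M, IsGeodesic cov γ ∧ γ 0 = x ∧ velocity I γ 0 = v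

/-- **Local existence of geodesics.** For a `C¹` connection on a Hausdorff manifold and an
interior point `x`, every tangent vector `v ∈ T_x M` is the initial velocity of a geodesic defined
on a neighbourhood of `0` (Picard–Lindelöf for the geodesic ODE in a chart; Hausdorffness provides
the bump functions globalising the local frame, so that the Christoffel symbols `∇ sᵢ` are `C¹`).
O'Neill 1983, Ch. 3, Lemma 3.22. [cite: ONeill1983, Ch. 3, Lemma 3.22] -/
def exists_isGeodesicOn_nhds_zero : Prop :=
  ∀ [CompleteSpace E] [T2Space M] [CovariantDerivative.ContMDiffCovariantDerivative cov 1] {x : M},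
    I.IsInteriorPoint x → ∀ v : TangentSpace I x, ∃ (γ : ℝ → M) (s : Set ℝ), s ∈ 𝓝 (0 : ℝ) ∧ IsGeodesicOn cov γ s ∧ γ 0 = x ∧
      velocity I γ 0 = v

/-- **Existence and uniqueness of the maximal geodesic** with given initial data: for a `C¹`
connection on a Hausdorff manifold without boundary and every `v ∈ T_x M` there is a maximal
geodesic `γ_v` with `γ_v(0) = x`, `γ_v'(0) = v`, and any other such maximal geodesic has the same
domain and agrees with it there. O'Neill 1983, Ch. 3, Lemma 3.22 and Prop. 3.28 ff. (p. 68);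
Hawking–Ellis 1973, §2.5 postulate and §8.1. [cite: ONeill1983, Ch. 3, Lemma 3.22 and Prop. 3.28 ff.] -/
def existsUnique_isMaximalGeodesicOn : Prop :=
  ∀ [CompleteSpace E] [T2Space M] [BoundarylessManifold I M] [CovariantDerivative.ContMDiffCovariantDerivative cov 1] (x : M) (v : TangentSpace I x),
    ∃ (γ : ℝ → M) (s : Set ℝ), (IsMaximalGeodesicOn cov γ s ∧ 0 ∈ s ∧ γ 0 = x ∧
      velocity I γ 0 = v) ∧
      ∀ (γ' : ℝ → M) (s' : Set ℝ), IsMaximalGeodesicOn cov γ' s' → 0 ∈ s' → γ' 0 = x →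
        velocity I γ' 0 = v → s' = s ∧ EqOn γ' γ s

/-- **Uniqueness of geodesics.** For a `C¹` connection on a Hausdorff manifold without boundary,
two geodesics on an open interval `s ∋ t₀` with the same position and velocity at `t₀` agree on
`s`. O'Neill 1983, Ch. 3, Lemma 3.22 and p. 68. [cite: ONeill1983, Ch. 3, Lemma 3.22 and p. 68] -/
def IsGeodesicOn.eqOn_of_velocity_eq : Prop :=
  ∀ [CompleteSpace E] [T2Space M] [BoundarylessManifold I M]
    [CovariantDerivative.ContMDiffCovariantDerivative cov 1] {γ γ' : ℝ → M} {s : Set ℝ},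
    IsOpen s → s.OrdConnected → IsGeodesicOn cov γ s → IsGeodesicOn cov γ' s →
    ∀ {t₀ : ℝ}, t₀ ∈ s → γ t₀ = γ' t₀ → velocity I γ t₀ = velocity I γ' t₀ → EqOn γ γ' s

end Geodesic

/-! ### Geodesics of a metric: conservation of `g(γ', γ')` -/

namespace PseudoRiemannianMetric

variable [IsManifold I ∞ M] [FiniteDimensional ℝ E] [CompleteSpace E] {n : ℕ∞ω} [Fact (1 ≤ n)]
  (g : PseudoRiemannianMetric I n E (TangentSpace I : M → Type _)) [g.HasLeviCivita]

/-- **Geodesics have constant speed.** Along a geodesic of the Levi-Civita connection of `g` on an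
open interval `s`, the quantity `g(γ', γ')` is constant (`d/dt g(γ',γ') = 2 g(Dγ'/dt, γ') = 0` by
metric compatibility); in particular the causal character of a Lorentzian geodesic is constant.
O'Neill 1983, Ch. 3, p. 69 (after Def. 3.23) and Ch. 5, p. 131. [cite: ONeill1983, Ch. 3, p. 69] -/
def val_velocity_eq_of_isGeodesicOn : Prop :=
  ∀ {γ : ℝ → M} {s : Set ℝ}, IsOpen s → s.OrdConnected → IsGeodesicOn g.leviCivita γ s →
    ∀ {t₁ t₂ : ℝ}, t₁ ∈ s → t₂ ∈ s →
      g.val (γ t₁) (velocity I γ t₁) (velocity I γ t₁) =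
        g.val (γ t₂) (velocity I γ t₂) (velocity I γ t₂)

end PseudoRiemannianMetric

/-! ### Lorentzian layer: causal geodesic completeness and incompleteness -/

namespace LorentzianMetric

variable [IsManifold I ∞ M] [FiniteDimensional ℝ E] [CompleteSpace E] {n : ℕ∞ω} [Fact (1 ≤ n)]
  (g : LorentzianMetric I n M) [g.HasLeviCivita]

/-- `g` is **timelike geodesically complete**: every timelike tangent vector is the initial
velocity of a geodesic of the Levi-Civita connection of `g` defined on all of `ℝ` (every
inextendible timelike geodesic is complete). Hawking–Ellis 1973, §8.1; O'Neill 1983, Ch. 5,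
p. 131. [cite: HawkingEllis1973, §8.1, pp. 257–258] -/
def IsTimelikeGeodesicallyComplete (g : LorentzianMetric I n M) [g.HasLeviCivita] : Prop :=
  ∀ (x : M) (v : TangentSpace I x), g.IsTimelike v →
    ∃ γ : ℝ → M, IsGeodesic g.leviCivita γ ∧ γ 0 = x ∧ velocity I γ 0 = v

/-- `g` is **null geodesically complete**: every null tangent vector is the initial velocity of a
geodesic of the Levi-Civita connection of `g` defined on all of `ℝ` (a *property* of `g`: e.g. the
Reissner–Nordström solution is timelike but not null geodesically complete, Hawking–Ellis p. 258).
Hawking–Ellis 1973, §8.1, pp. 257–258; O'Neill 1983, Ch. 5, p. 131. [cite: HawkingEllis1973, §8.1, pp. 257–258] -/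
def IsNullGeodesicallyComplete (g : LorentzianMetric I n M) [g.HasLeviCivita] : Prop :=
  ∀ (x : M) (v : TangentSpace I x), g.IsNull v →
    ∃ γ : ℝ → M, IsGeodesic g.leviCivita γ ∧ γ 0 = x ∧ velocity I γ 0 = v

/-- `g` is **causal (non-spacelike) geodesically complete**: every causal tangent vector is the
initial velocity of a geodesic of the Levi-Civita connection defined on all of `ℝ`. A spacetime
is *singularity-free* in the sense of Hawking–Ellis iff it is causal geodesically complete.
Hawking–Ellis 1973, §8.1, pp. 257–258; O'Neill 1983, Ch. 5, p. 131. [cite: HawkingEllis1973, §8.1, pp. 257–258] -/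
def IsCausalGeodesicallyComplete (g : LorentzianMetric I n M) [g.HasLeviCivita] : Prop :=
  ∀ (x : M) (v : TangentSpace I x), g.IsCausal v →
    ∃ γ : ℝ → M, IsGeodesic g.leviCivita γ ∧ γ 0 = x ∧ velocity I γ 0 = v

omit [CompleteSpace E] [Fact (1 ≤ n)] in
/-- Causal completeness is timelike and null completeness together (a causal vector is timelike
or null). Hawking–Ellis 1973, §8.1. [cite: HawkingEllis1973, §8.1] -/
lemma isCausalGeodesicallyComplete_iff :
    g.IsCausalGeodesicallyComplete ↔
      g.IsTimelikeGeodesicallyComplete ∧ g.IsNullGeodesicallyComplete := by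
  refine ⟨fun h ↦ ⟨fun x v hv ↦ h x v hv.isCausal, fun x v hv ↦ h x v hv.isCausal⟩,
    fun h x v hv ↦ ?_⟩
  rcases (g.isCausal_iff_isTimelike_or_isNull v).mp hv with hv' | hv'
  · exact h.1 x v hv'
  · exact h.2 x v hv'

omit [CompleteSpace E] [Fact (1 ≤ n)] in
/-- A geodesically complete Levi-Civita connection is causal geodesically complete.
Hawking–Ellis 1973, §8.1. [cite: HawkingEllis1973, §8.1] -/
lemma isCausalGeodesicallyComplete_of_isGeodesicallyComplete
    (h : IsGeodesicallyComplete g.leviCivita) : g.IsCausalGeodesicallyComplete :=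
  fun x v _ ↦ h x v

variable {g} (τ : TimeOrientation g)

/-- `(M, g, τ)` is **future null geodesically incomplete**: there is a maximal (inextendible)
geodesic whose velocity is everywhere null and future-directed and whose (affine) parameter
domain is bounded above — a future-incomplete null geodesic, the conclusion of the Penrose
singularity theorem. Hawking–Ellis 1973, §8.1 and §8.2, Thm. 1. [cite: HawkingEllis1973, §8.1 and §8.2, Thm. 1] -/
def IsFutureNullGeodesicallyIncomplete (τ : TimeOrientation g) : Prop :=
  ∃ (γ : ℝ → M) (s : Set ℝ), IsMaximalGeodesicOn g.leviCivita γ s ∧ s.Nonempty ∧ BddAbove s ∧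
    ∀ t ∈ s, g.IsNull (velocity I γ t) ∧ τ.IsFutureDirected (velocity I γ t)

/-- `(M, g, τ)` is **future timelike geodesically incomplete**: there is a maximal geodesic whose
velocity is everywhere timelike and future-directed and whose affine parameter (proportional to
proper time) is bounded above — a freely falling observer whose history ends after finite proper
time, the conclusion of Hawking's singularity theorem. Hawking–Ellis 1973, §8.1 and §8.2,
Thm. 4. [cite: HawkingEllis1973, §8.1 and §8.2, Thm. 4] -/
def IsFutureTimelikeGeodesicallyIncomplete (τ : TimeOrientation g) : Prop :=
  ∃ (γ : ℝ → M) (s : Set ℝ), IsMaximalGeodesicOn g.leviCivita γ s ∧ s.Nonempty ∧ BddAbove s ∧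
    ∀ t ∈ s, g.IsTimelike (velocity I γ t) ∧ τ.IsFutureDirected (velocity I γ t)

/-- A future null geodesically incomplete metric on a Hausdorff manifold without boundary (with a
`C¹` Levi-Civita connection) is not null geodesically complete: the incomplete maximal geodesic
would have to coincide with the complete one with the same initial data.
Hawking–Ellis 1973, §8.1. [cite: HawkingEllis1973, §8.1] -/
def not_isNullGeodesicallyComplete_of_isFutureNullGeodesicallyIncomplete : Prop :=
  ∀ [T2Space M] [BoundarylessManifold I M]
    [CovariantDerivative.ContMDiffCovariantDerivative g.leviCivita 1],
    IsFutureNullGeodesicallyIncomplete τ → ¬ g.IsNullGeodesicallyComplete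

/-- A future timelike geodesically incomplete metric on a Hausdorff manifold without boundary
(with a `C¹` Levi-Civita connection) is not timelike geodesically complete.
Hawking–Ellis 1973, §8.1. [cite: HawkingEllis1973, §8.1] -/
def not_isTimelikeGeodesicallyComplete_of_isFutureTimelikeGeodesicallyIncomplete : Prop :=
  ∀ [T2Space M] [BoundarylessManifold I M]
    [CovariantDerivative.ContMDiffCovariantDerivative g.leviCivita 1],
    IsFutureTimelikeGeodesicallyIncomplete τ → ¬ g.IsTimelikeGeodesicallyComplete

end LorentzianMetric

end Literature.Geometry.Lorentzian

end
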